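/-
Copyright: lit-balaban cell, Phase-2 proof seat p11 (gen 7; v1.1 docstring correction gen 8).  Statement-level skeleton of a published
paper; no proof claims beyond what the kernel checks below.
-/
import Literature.MathematicalPhysics.QuantumFieldTheory.BalabanImbrieJaffe1984to88.BIJ85AxialLineSum
import Literature.MathematicalPhysics.QuantumFieldTheory.BalabanImbrieJaffe1984to88.BIJ85LineSumExact

/-!
# `BalabanImbrieJaffe1984to88.BIJ85LineSumCentre` — T. Bałaban, J. Imbrie, A. Jaffe, *Renormalization of the Higgs model: minimizers,
propagators and the stability of mean field theory*, Commun. Math. Phys. **97** (1985) 299–329 [BalabanImbrieJaffe1985]: Sect. 7.3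
p. 326 — **THE CENTRE-LINE DEFECT OF THE SECOND PRINTED FORM OF (7.3.2) ON EXACT FIELDS IS THE CENTRE DIFFERENCE OF PROP. 5.2.2's GAUGE
FUNCTION `D`, UP TO `O(K_R·max|∂B|)` UNIFORMLY IN THE SCALE AND IN THE VOLUME** (file 3 of the gen-7 member of SKELETON row
**C1.Eq7.3.1-7.3.2**; file 1 = `BIJ85TreeGaugeLineSums`, file 2 = `BIJ85AxialLineSum`).

statement-level skeleton of published theorems with citation tags; proofs where landed; nothing here is a claim about the Yang–Mills mass gap

PDF held: `paper:balaban1985-cmp97-bij-higgs-minimizers` (journal page = PDF page + 298).  Pages re-read this session (OCR text):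
p. 312–313 [PDF 14–15] ((4.5.1)–(4.5.4), (5.1.1)–(5.1.2)), p. 316–317 [PDF 18–19] ((5.2.6)–(5.2.10), (5.3.1)), p. 326 [PDF 28]; v1.1: p0014,
p0015, p0018, p0028 re-read on the OCR layer (referee ref-1's gen-48 sweep request: two glosses stood inside quotation marks in v1 — the
p. 326 passage carried the words «Also,», «with estimates depending on Λ» and «Alternatively,», which are not print, and (4.5.3) was quoted
in a contour-holonomy paraphrase with the locator p. 313; both corrected below, nothing else in the file changes).

CITATION HEADER (lean-in-tree rule).  Phase-2 file of the lit-balaban TYPED SKELETON (HOME `run/shared/lean/pub/lit-balaban/`), seat p11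
gen 7 (unit `lit-balaban-p11-g7`; TAKING line HOME/STATUS.md 2026-08-21T22:35:54Z; owner r15, referee ref-5).  Objects BY NAME, nothing
re-declared: p31's `BIJ88Eq541Base0.TkF` (`T_k = 𝒟_k∂^*Q^{e*}_k`, the smoothing operator of (4.5.4)); p11/p30's `BIJ85Prop522Torus.DkE`/`HaxE`/
`GaxE`/`D527E`/`prop522_torus_apply` ((4.4.4), (4.1.3), (5.2.2), (5.2.6)–(5.2.7)); p30's `BIJ85Eq625Torus.HaxE_eq_531` ((5.3.1)); p09's
`QsE`/`QesOp`/`curlOp`; p33's `dOne`; p31's `BIJ85Eq531Inputs.QsstarIter` with `BIJ85Eq219Proof.segSum_Qsstar` (every straight fine line across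
a block face carries `L·B_b`); file 1's `cline`/`cline_succ`/`embIter_runSite`/`emb_eq_blockSite`; file 2's
`abs_sub_eta_cline_hax_le`, `exists_KH_allTori` (and through it p33/p30/p19's all-tori `K_R`); gen 6's `BIJ85LineSumExact.TkF_dOne_apply`.
Theorems only: no `def`, no named fact (D-0026).

THE PRINTED TEXT, verbatim.  p. 326 [PDF 28] l. 17–18 and l. 20–25: *"The second form of the inequality substitutes v_b for u_k(b) in the
covariant derivative of φ. These inequalities can be proved by an extension of the proofs of [7]."* … *"In order to remain within the
framework of this reference, we remark that by change of gauge u_k can be transformed in a local region Λ into a configuration of the form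
exp[ie_kηA], where A is smooth and small. In axial gauge for the configuration v in a domain Λ′ ⊃ Λ we can substitute 𝒟_k∂^* = G_{k,Ax}∂^*
+ ∂D in the formula for u_k, we use (5.3.1) to replace this by a minimizer in axial gauge."*; p. 316 [PDF 18]:
*"Proposition 5.2.2. There is a gauge transformation D such that G_{k,Ax}∂^* − 𝒟_k∂^* = ∂D. (5.2.6) Explicitly D = Σ_{j=0}^{k−1}
λ_j(H_jC^{(j)}H_j^*∂^*), (5.2.7)"*; p. 317 [PDF 19]: *"H_{k,Ax}B = Q^{s*}_kB − G_{k,Ax}∂^*Q^{e*}_k∂B. (5.3.1)"*; p. 312 [PDF 14] l. 33–40: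
*"The independence of the resulting transformation on this choice follows from the equivalent definition: (Q^{s*}_kv)_b = 1 if b is
strictly contained in a k-block (both endpoints belong to the block); = v_c if the η-lattice bond b belongs to the corridor of bonds
connecting the two blocks B^k(c₋) and B^k(c₊). Here c is a unit lattice bond. (4.5.3)"*.  READING (ours, NOT print; v1 had it inside
quotation marks with the locator p. 313): for a fine bond `b = (xx′)` and the composite contours of (5.1.2) the holonomy of `Q^{s*}_kv`
along `Γ_{x_k,…,x} ∪ b ∪ Γ_{x′_k,…,x′}^{−1}` equals `v_{b′}`, `b′ = (x_kx′_k)` — the form of (4.5.3) used by `cline_QsstarIter` below (one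
face-crossing bond per centre line and level).

WHAT IS PROVED HERE (0 `sorry`, standard axioms; standing range `k ≤ m + K`, `2 ≤ d`).
* §1 **`DkE_dOne_eq_axial`** — the first two of the three printed steps (the third, (5.1.1), is gen 6's `BIJ85LineSumExact.DkE_dOne_eq`):
  `𝒟_k∂^*Q^{e*}_k∂B = Q^{s*}_kB − H_{k,Ax}B − ∂D(Q^{e*}_k∂B)` for every `w > 0`, `c ≠ 0`; `TkF_dOne_eq_axial` (p31's `T_k` at `∂B` componentwise).
* §2 centre line sums (file 1's `cline`, the straight run of `L^k` fine bonds from the iterated block centre `embIter`): linearity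
  (`cline_add/sub/smul/congr`), **`cline_QsstarIter`** (`Σ_{centre line of b}(Q^{s*}_kB) = L^k·B_b` — (4.5.3) in the Lie algebra for the centre
  line: one face-crossing bond, by p31's `segSum_Qsstar` at every level), **`cline_grad`** (`Σ_{centre line of b}(∂_cΓ) =
  c·[Γ(embIter_k b₊) − Γ(embIter_k b₋)]`).
* §3 **`eta_cline_TkF_exact`** — THE CENTRE-LINE DEFECT ON EXACT FIELDS AS AN IDENTITY:
  `η·Σ_{centre line of b}(T_k∂B) = B_b − η·Σ_{centre line of b}(H_{k,Ax}B) − [D(J)(embIter_k b₊) − D(J)(embIter_k b₋)]`, `J = Q^{e*}_k∂B` (weights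
  of record `w = η^d`, `c = η⁻¹`); hence with file 2: **`abs_eta_cline_TkF_add_D_le`** (one torus, given the residual constant `K_R`) and
  **`exists_KD_reduction_allTori`** (HYPOTHESIS-FREE, ONE constant over all tori of a dimension and block size, all scales `1 ≤ k ≤ m + K`):
  `|η·Σ_{centre line of b}(T_k∂B) + [D(J)(c₊) − D(J)(c₋)]| ≤ K·max_q|(∂B)(q)|`, `K = (d/2)·K_R` — i.e. the located line-sum constant `K_T`
  of gen 6 (`BIJ85Claim73SecondForm.SecClosedIdx.hT`), READ ALONG CENTRE LINES and on exact fields, is REDUCED to ONE quantity: the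
  difference of Prop. 5.2.2's gauge function `D(Q^{e*}_k∂B)` ((5.2.7)) between the centres of adjacent `k`-blocks.  No `K_H`, no `λ_k`.
HONEST SCOPE.  (i) CENTRE lines, not the corner lines of gen 6's `lineSumIter` (see file 2's scope note and GAPS G-C1-05 ADDENDUM 6: the
corner line of print's convention (2.4) starts at the junction of the flux tubes of `Q^{e*}_k`, the centre line stays at distance `½`; the
bridge corner ↔ centre is NOT claimed).  (ii) The centre difference of `D` is NOT bounded here: `D = Σ_{j<k} λ_j(H_jC^{(j)}H_j^*∂^*J)` is a
multiscale object whose uniform control needs (7.2.2)–(7.2.4) at every level `j < k` with the geometric factors — the part print calls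
*"an extension of the proofs of [7]"*; it is recorded as the located remainder.  (iii) Exact unit fields `∂B` (harmonic sources as in GAPS
G-C1-05 ADDENDUM 4a); `U = 1` real abelian fields; torus; constants explicit, not optimised.  Nothing here is summit progress.
-/

open scoped BigOperators RealInnerProductSpace
open Finset

namespace Literature.MathematicalPhysics.QuantumFieldTheory.BalabanImbrieJaffe1984to88.BIJ85LineSumCentre

open Literature.MathematicalPhysics.QuantumFieldTheory.Balaban1983to89 hiding Site Plaq
open Balaban1983to89.LatticeFieldCalculus
open BIJ85AxialPropagator411 (BondSpace PlaqSpace curlOp toE)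
open BIJ85Eq531Inputs (QsstarIter QsstarIter_succ)
open BIJ85Eq219Proof (torusBlockBonds segSum_Qsstar)
open BIJ85Prop521Torus (CoarseSpace toEj QsE QsE_apply)
open BIJ85Prop522Torus (DkE HkE HaxE GaxE D527E prop522_torus_apply)
open BIJ85LandauMinimizer442V1 (gradV1 gradV1_apply)
open BIJ85Sigma421Torus (toU QesOp UnitPlaqSpace)
open BIJ85Sigma422Eta (eta_pos eta_inv)
open BIJ85Eq611Torus (dOne)
open BIJ85Eq625Torus (HaxE_eq_531)
open BIJ85Eq454PlaqResidual (resE eta_mul_L_pow)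
open BIJ85UnitTorusHodge (IsClosedPlaq)
open BIJ88Eq541Base0 (TkF TkF_apply)
open BIJ85LineSumExact (TkF_dOne_apply)
open BIJ85TreeGaugeLineSums (cline cline_succ embIter_runSite emb_eq_blockSite)
open BIJ85AxialLineSum (abs_sub_eta_cline_hax_le exists_KH_allTori)
open B15DeterminingSets (embIter)
open Balaban1983to89 renaming Site → TSite, Plaq → TPlaq

noncomputable section

variable {P : Params}

/-! ## §1  `T_k∂B = Q^{s*}_kB − H_{k,Ax}B − ∂D(Q^{e*}_k∂B)` from (5.3.1) and (5.2.6) -/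

/-- **`𝒟_k∂^*Q^{e*}_k∂B = Q^{s*}_kB − H_{k,Ax}B − ∂D(Q^{e*}_k∂B)`** on the Euclidean carriers of the tori, for every unit-lattice bond field
`B`, every `w > 0`, `c ≠ 0` (`k ≤ m + K`, `2 ≤ d`) — (5.3.1) `H_{k,Ax}B = Q^{s*}_kB − G_{k,Ax}∂^*Q^{e*}_k∂B` (p30's `HaxE_eq_531`) and
(5.2.6) `G_{k,Ax}∂^* = 𝒟_k∂^* + ∂D` (gen 1's `prop522_torus_apply`): the AXIAL form of gen 6's `BIJ85LineSumExact.DkE_dOne_eq` (which continues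
with (5.1.1) to the Landau minimizer). [cite: BalabanImbrieJaffe1985, (5.3.1) p.317] -/
theorem DkE_dOne_eq_axial (hd : 2 ≤ P.d) {k : ℕ} (hk : k ≤ P.m + P.K) {c : ℝ} (hc : c ≠ 0) {w : ℝ} (hw : 0 < w)
    (B : CoarseSpace P k) :
    DkE P w c k (LinearMap.adjoint (curlOp (P := P) w c) (QesOp (P := P) hd w k (dOne P k c B))) =
      QsE P k B - HaxE P w c k B - gradV1 P c (D527E P w c k (QesOp (P := P) hd w k (dOne P k c B))) := by
  set J : PlaqSpace P := QesOp (P := P) hd w k (dOne P k c B) with hJ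
  have h531 : HaxE P w c k B = QsE P k B - GaxE P w c k (LinearMap.adjoint (curlOp (P := P) w c) J) := by
    have h := LinearMap.congr_fun (HaxE_eq_531 hd hk hc hw) B
    simpa only [LinearMap.sub_apply, LinearMap.coe_comp, Function.comp_apply] using h
  have h522 := prop522_torus_apply hk hc hw J
  have e1 : GaxE P w c k (LinearMap.adjoint (curlOp (P := P) w c) J) = QsE P k B - HaxE P w c k B := by rw [h531]; abel
  rw [eq_sub_of_add_eq h522.symm, e1]

/-- p31's `T_k` at the exact field `∂B` (unit-lattice curl `dOne` at `c = η⁻¹`), componentwise, in the AXIAL form: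
`(T_k∂B)(b′) = (Q^{s*}_kB)(b′) − (H_{k,Ax}B)(b′) − (∂D(J))(b′)` (weights `w > 0`, `η > 0`; `k ≤ m + K`, `2 ≤ d`). [cite: BalabanImbrieJaffe1985, (4.5.4) p.313] -/
theorem TkF_dOne_eq_axial (hd : 2 ≤ P.d) {k : ℕ} (hk : k ≤ P.m + P.K) {w : ℝ} (hw : 0 < w) {η : ℝ} (hη : η ≠ 0)
    (B : CoarseSpace P k) (b : PBond P 0) :
    TkF P hd w η k (fun p => dOne P k η⁻¹ B p) b =
      QsE P k B b - HaxE P w η⁻¹ k B b - gradV1 P η⁻¹ (D527E P w η⁻¹ k (QesOp (P := P) hd w k (dOne P k η⁻¹ B))) b := by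
  rw [TkF_dOne_apply, DkE_dOne_eq_axial hd hk (inv_ne_zero hη) hw B]
  rfl

/-! ## §2  Centre line sums: linearity, the pull-back `Q^{s*}_k`, gradients -/

/-- `cline` is additive in the field. [cite: BalabanImbrieJaffe1985, (5.1.2) p.313] -/
theorem cline_add (k : ℕ) (A A' : VecField P 0 ℝ) (b : PBond P k) : cline k (A + A') b = cline k A b + cline k A' b := by
  simp [cline, segSum, sum_add_distrib]

/-- `cline` commutes with subtraction of fields. [cite: BalabanImbrieJaffe1985, (5.1.2) p.313] -/
theorem cline_sub (k : ℕ) (A A' : VecField P 0 ℝ) (b : PBond P k) : cline k (A - A') b = cline k A b - cline k A' b := by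
  simp [cline, segSum, sum_sub_distrib]

/-- `cline` is homogeneous in the field. [cite: BalabanImbrieJaffe1985, (5.1.2) p.313] -/
theorem cline_smul (k : ℕ) (a : ℝ) (A : VecField P 0 ℝ) (b : PBond P k) : cline k (a • A) b = a * cline k A b := by
  simp [cline, segSum, mul_sum]

/-- `cline` depends only on the values of the field (pointwise congruence). [cite: BalabanImbrieJaffe1985, (5.1.2) p.313] -/
theorem cline_congr (k : ℕ) {A A' : VecField P 0 ℝ} (h : ∀ b', A b' = A' b') (b : PBond P k) : cline k A b = cline k A' b := by
  simp only [cline, segSum, h]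

/-- **(4.5.3) IN THE LIE ALGEBRA, CENTRE LINE**: `Σ_{centre line of b}(Q^{s*}_kB) = L^k·B_b` — the straight fine line from the iterated centre
`embIter_k(b₋)` to `embIter_k(b₊)` crosses the face of `b` at exactly one bond, which carries `L^k·B_b` (by levels: p31's `segSum_Qsstar`, every
straight line of a block; file 1's `cline_succ`; standing range `k ≤ m + K`). [cite: BalabanImbrieJaffe1985, (4.5.3) p.313] -/
theorem cline_QsstarIter : ∀ (k : ℕ), k ≤ P.m + P.K → ∀ (B : PBond P k → ℝ) (b : PBond P k),
    cline k (QsstarIter k B) b = (P.L : ℝ) ^ k * B b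
  | 0, _, B, b => by simp [BIJ85TreeGaugeLineSums.cline_zero]
  | k + 1, hk, B, b => by
    rw [cline_succ hk, QsstarIter_succ]
    have ih : ∀ t, cline k (QsstarIter k ((torusBlockBonds P k).Qsstar B)) (runBond (emb b.src) b.dir t)
        = (P.L : ℝ) ^ k * (torusBlockBonds P k).Qsstar B (runBond (emb b.src) b.dir t) :=
      fun t => cline_QsstarIter k (by omega) _ _
    simp only [ih, ← mul_sum]
    rw [show ∑ t ∈ range P.L, (torusBlockBonds P k).Qsstar B (runBond (emb b.src) b.dir t)
        = segSum (V := ℝ) ((torusBlockBonds P k).Qsstar B) (emb b.src) b.dir P.L from rfl,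
      emb_eq_blockSite, segSum_Qsstar hk, pow_succ]
    have hb : (⟨b.src, b.dir⟩ : PBond P (k + 1)) = b := rfl
    rw [hb]
    ring

/-- `cline` of the Euclidean pull-back `QsE`: `Σ_{centre line of b}(Q^{s*}_kB) = L^k·B_b` (standing range). [cite: BalabanImbrieJaffe1985, (4.5.3) p.313] -/
theorem cline_QsE {k : ℕ} (hk : k ≤ P.m + P.K) (B : CoarseSpace P k) (b : PBond P k) :
    cline k (fun b' => QsE P k B b') b = (P.L : ℝ) ^ k * B b := by
  rw [show (fun b' => QsE P k B b') = QsstarIter k (WithLp.ofLp B) from by funext b'; rw [QsE_apply]; rfl]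
  exact cline_QsstarIter k hk _ b

/-- kernel: one coarse step along the centre line is `L^k` fine steps: `embIter_k(y + e_μ) = embIter_k(y) + L^ke_μ` (standing range).
[cite: Balaban1987RG1, (0.1) p.252] -/
theorem embIter_shift {k : ℕ} (hk : k ≤ P.m + P.K) (y : TSite P k) (μ : Fin P.d) :
    embIter k (y.shift μ) = runSite (embIter k y) μ (P.L ^ k) := by
  have h := embIter_runSite k hk y μ 1
  rw [one_mul] at h
  rw [← h]
  congr 1
  funext κ
  by_cases hκ : κ = μ
  · subst hκ; simp [runSite, Balaban1983to89.Site.shift]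
  · simp [runSite, Balaban1983to89.Site.shift, Function.update_of_ne hκ]

/-- **The centre line sum of a gradient telescopes**: `Σ_{centre line of b}(∂_cΓ) = c·[Γ(embIter_k b₊) − Γ(embIter_k b₋)]` (r18's `segSum_grad`
along the run of `L^k` bonds; standing range). [cite: BalabanImbrieJaffe1985, (5.1.2) p.313] -/
theorem cline_grad {k : ℕ} (hk : k ≤ P.m + P.K) (c : ℝ) (Γ : SiteField P 0 ℝ) (b : PBond P k) :
    cline k (grad c Γ) b = c * (Γ (embIter k b.tgt) - Γ (embIter k b.src)) := by
  unfold cline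
  rw [segSum_grad, smul_eq_mul, PBond.tgt, embIter_shift hk]

/-- `cline` of the Euclidean gradient `gradV1 P c Γ` read as a function. [cite: BalabanImbrieJaffe1985, (5.1.2) p.313] -/
theorem cline_gradV1 {k : ℕ} (hk : k ≤ P.m + P.K) (c : ℝ) (Γ : EuclideanSpace ℝ (TSite P 0)) (b : PBond P k) :
    cline k (fun b' => gradV1 P c Γ b') b = c * (Γ (embIter k b.tgt) - Γ (embIter k b.src)) := by
  rw [show (fun b' => gradV1 P c Γ b') = grad c (fun x => Γ x) from by funext b'; rw [gradV1_apply]]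
  exact cline_grad hk c _ b

/-! ## §3  The centre-line defect on exact fields -/

/-- **THE CENTRE-LINE DEFECT ON EXACT FIELDS, AS AN IDENTITY**: for every unit-lattice bond field `B` on `T^{(k)}` and every unit bond `b`
(`k ≤ m + K`, `2 ≤ d`; weights of record `w = η^d`, `c = η⁻¹`, `J = Q^{e*}_k∂B`):
`η·Σ_{centre line of b}(T_k∂B) = B_b − η·Σ_{centre line of b}(H_{k,Ax}B) − [D(J)(embIter_k b₊) − D(J)(embIter_k b₋)]` — the p. 326 route read
along the centre line: the pull-back contributes `B_b` ((4.5.3)), the axial minimizer its centre-line average, Prop. 5.2.2's gauge function its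
centre difference. [cite: BalabanImbrieJaffe1985, (7.3.2) p.326] -/
theorem eta_cline_TkF_exact (hd : 2 ≤ P.d) {k : ℕ} (hk : k ≤ P.m + P.K) (B : CoarseSpace P k) (b : PBond P k) :
    P.eta k * cline k (TkF P hd ((P.eta k) ^ P.d) (P.eta k) k (fun p => dOne P k (P.eta k)⁻¹ B p)) b =
      B b - P.eta k * cline k ((WithLp.ofLp (HaxE P ((P.eta k) ^ P.d) (P.eta k)⁻¹ k B))) b
        - (D527E P ((P.eta k) ^ P.d) (P.eta k)⁻¹ k (QesOp (P := P) hd ((P.eta k) ^ P.d) k (dOne P k (P.eta k)⁻¹ B)) (embIter k b.tgt)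
          - D527E P ((P.eta k) ^ P.d) (P.eta k)⁻¹ k (QesOp (P := P) hd ((P.eta k) ^ P.d) k (dOne P k (P.eta k)⁻¹ B)) (embIter k b.src)) := by
  have hw : 0 < (P.eta k) ^ P.d := pow_pos (eta_pos P k) _
  have hη : P.eta k ≠ 0 := (eta_pos P k).ne'
  set Γ := D527E P ((P.eta k) ^ P.d) (P.eta k)⁻¹ k (QesOp (P := P) hd ((P.eta k) ^ P.d) k (dOne P k (P.eta k)⁻¹ B)) with hΓ
  -- the bond function T_k∂B, componentwise, in the axial form
  have hT : (TkF P hd ((P.eta k) ^ P.d) (P.eta k) k (fun p => dOne P k (P.eta k)⁻¹ B p) : VecField P 0 ℝ)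
      = (fun b' => QsE P k B b') - (WithLp.ofLp (HaxE P ((P.eta k) ^ P.d) (P.eta k)⁻¹ k B)) - (fun b' => gradV1 P (P.eta k)⁻¹ Γ b') := by
    funext b'
    rw [TkF_dOne_eq_axial hd hk hw hη B b']
    rfl
  rw [hT, cline_sub, cline_sub, cline_QsE hk, cline_gradV1 hk, mul_sub, mul_sub, ← mul_assoc, eta_mul_L_pow, one_mul, ← mul_assoc,
    mul_inv_cancel₀ hη, one_mul]

/-- **THE CENTRE-LINE DEFECT IS THE CENTRE DIFFERENCE OF `D`, UP TO `(d/2)·K_R·max|∂B|`** — one torus `P`, one scale `k ≤ m + K`, GIVEN the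
residual bound with constant `K_R` on `P` at scale `k` (`2 ≤ d`): for every unit-lattice bond field `B` with `|(∂B)(q)| ≤ s` and every unit
bond `b`, `|η·Σ_{centre line of b}(T_k∂B) + [D(J)(embIter_k b₊) − D(J)(embIter_k b₋)]| ≤ (d/2)·K_R·s` (file 2's `abs_sub_eta_cline_hax_le`).
[cite: BalabanImbrieJaffe1985, (7.3.2) p.326] -/
theorem abs_eta_cline_TkF_add_D_le (hd : 2 ≤ P.d) {k : ℕ} (hk : k ≤ P.m + P.K) {KR : ℝ}
    (hR : ∀ (f : TPlaq P k → ℝ), IsClosedPlaq f → ∀ (s : ℝ), 0 ≤ s → (∀ q, |f q| ≤ s) →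
      ∀ p : TPlaq P 0, |resE hd ((P.eta k) ^ P.d) (P.eta k)⁻¹ k (toU P k f) p| ≤ KR * Real.sqrt ((P.eta k) ^ P.d) * s)
    (hKR : 0 ≤ KR) (B : CoarseSpace P k) {s : ℝ} (hs0 : 0 ≤ s) (hs : ∀ q, |curl 1 (WithLp.ofLp B) q| ≤ s) (b : PBond P k) :
    |P.eta k * cline k (TkF P hd ((P.eta k) ^ P.d) (P.eta k) k (fun p => dOne P k (P.eta k)⁻¹ B p)) b
      + (D527E P ((P.eta k) ^ P.d) (P.eta k)⁻¹ k (QesOp (P := P) hd ((P.eta k) ^ P.d) k (dOne P k (P.eta k)⁻¹ B)) (embIter k b.tgt)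
          - D527E P ((P.eta k) ^ P.d) (P.eta k)⁻¹ k (QesOp (P := P) hd ((P.eta k) ^ P.d) k (dOne P k (P.eta k)⁻¹ B)) (embIter k b.src))|
      ≤ (P.d : ℝ) / 2 * KR * s := by
  rw [eta_cline_TkF_exact hd hk B b, sub_add_cancel]
  exact abs_sub_eta_cline_hax_le hd hk hR hKR B hs0 hs b

/-- **HYPOTHESIS-FREE, ONE CONSTANT FOR ALL TORI**: for every dimension `d ≥ 2` and block size `L` there is `K ≥ 0` such that for EVERY torus `P`
of the series with `P.d = d`, `P.L = L`, every scale `1 ≤ k ≤ m + K`, every unit-lattice bond field `B` on `T^{(k)}` with `|(∂B)(q)| ≤ s` and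
every unit bond `b`: `|η·Σ_{centre line of b}(T_k∂B) + [D(J)(embIter_k b₊) − D(J)(embIter_k b₋)]| ≤ K·s`, `J = Q^{e*}_k∂B`, `K = (d/2)·K_R` — the
located line-sum constant of the second printed form of (7.3.2), along centre lines and on exact fields, REDUCED to the centre differences
of Prop. 5.2.2's gauge function `D` alone (file 2's `exists_KH_allTori`). [cite: BalabanImbrieJaffe1985, (7.3.2) p.326] -/
theorem exists_KD_reduction_allTori {d L : ℕ} (hd : 2 ≤ d) :
    ∃ K : ℝ, 0 ≤ K ∧ ∀ (P : Params) (hPd : P.d = d), P.L = L → ∀ (k : ℕ), 1 ≤ k → (hk : k ≤ P.m + P.K) →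
      ∀ (B : CoarseSpace P k) (s : ℝ), 0 ≤ s → (∀ q, |curl 1 (WithLp.ofLp B) q| ≤ s) → ∀ b : PBond P k,
        |P.eta k * cline k (TkF P (hd.trans_eq hPd.symm) ((P.eta k) ^ P.d) (P.eta k) k (fun p => dOne P k (P.eta k)⁻¹ B p)) b
          + (D527E P ((P.eta k) ^ P.d) (P.eta k)⁻¹ k
                (QesOp (P := P) (hd.trans_eq hPd.symm) ((P.eta k) ^ P.d) k (dOne P k (P.eta k)⁻¹ B)) (embIter k b.tgt)
              - D527E P ((P.eta k) ^ P.d) (P.eta k)⁻¹ k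
                (QesOp (P := P) (hd.trans_eq hPd.symm) ((P.eta k) ^ P.d) k (dOne P k (P.eta k)⁻¹ B)) (embIter k b.src))| ≤ K * s := by
  obtain ⟨KH, hKH0, hKH⟩ := exists_KH_allTori (L := L) hd
  refine ⟨KH, hKH0, fun P hPd hPL k hk1 hk B s hs0 hs b => ?_⟩
  rw [eta_cline_TkF_exact (hd.trans_eq hPd.symm) hk B b, sub_add_cancel]
  exact hKH P hPd hPL k hk1 hk B s hs0 hs b

end

end Literature.MathematicalPhysics.QuantumFieldTheory.BalabanImbrieJaffe1984to88.BIJ85LineSumCentre
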